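import Summits.RiemannHypothesis.RiemannHypothesis.Theorems.TiltedLandingLaw421R3RateSkeletonWalk

/-! # RATE residual `RhW08.RateSplit.RateLawsHalfQ` — LENS-2 WALK MODULE, part B: §W GLUE-G3A PROVED on the MOVING-CHILD laws
Landing cut (3l-B) of `rh33346-cover/lens2/RateSkeletonWalk-v2.lean` b58268a5, l.385–654, re-pointed to the PRIMED (moving-child) twins of
`…R3RateSkeletonB` — the only textual change is `X ↦ X'` on the cone names (37 tokens: `FarNode` 13, `LandingExitLawAbove` 4, `ThresholdCapLawCharged` 3,
`ThresholdCapLawBelow` 3, `UnchargedCreepLaw` 3, `FarChainEntryExitLaw` 3, `FarFieldModulusLawA` 2, `F1OfModulusLawA` 2, `FarEntry` 1,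
`no_charge_after_landing_above` 1, `farChainEntryLawCharged_of_exit` 1, `ModulusOfLawsG3A` 1 (docstring)); the walk itself is binder-blind (it reads the
binder only as the third conjunct of `FarNode'` and hands it to the laws unchanged).  Content: `LowLandingLaw` (T-LOW, typed over `FarNode'`), the node
lemmas `nestedStep_of_binder`, `im_le_of_binder`, `child_le_state`, `lowest_le_child` (hazard B-β PROVED from `RhW08.SuccB.stTrkDQ_succ_of_nested`),
`child_mono`, `state_drop` (PROVED: `ReadyR2` is state-free and cumulative), `B_walk_le_two`, `final_factor_le`, GLUE-G3A
`modulusLawA_of_laws : λ₀² ≤ 5/4 → LandingExitLawAbove' (5/4) 2 → LowLandingLaw (5/4) 2 → ThresholdCapLawCharged' θ → ThresholdCapLawBelow' θ →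
UnchargedCreepLaw' θu → FarChainEntryExitLaw' θ' → FarFieldModulusLawA' (λ₀(1+θu/5))`, `λ₀ = (1+θ)(1+θ')e^{2θu}`, the record constant
`lam_sq_le_recordB` (θ = 1/200, θ' = 1/25, θu = 3/100: λ = 1.1165, λ² = 1.2466 ≤ 5/4, kernel) and the F1 assembly
`farEnergyLawCQ_of_lawsB : F1OfModulusLawA' → (the six laws of record) → FarEnergyLawCQ (4/5)`.  All one-level laws are TYPED, not proved (their stubs
live in the registry line).  Sorry-free; axioms standard.  Nothing here bears on the truth of RH; RH is not proved; 33346/33347 OPEN; checked ≠ proved. -/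

namespace RhW08.BurgersRateG3
open Complex
open scoped ComplexConjugate
open RhW08.Round1 RhW08.StSwap RhW08.Round2 RhW08.QuadW
open RhW08.SealSwap (PBot)
open RhW08.SealSwapQ RhW08.RateSplit RhW08.IsolatedTilt RhW08.FarStep RhW08.BurgersRate RhW08.PurseP
open RhIdea6.G17.W07C7 RhIdea6.G17.W07C7.Rev6 RhIdea6.G18.W07C8.Law421BirthS RhIdea6.G19.W07C11.Seam
open RhIdea6.G20.W07C12.Frac RhIdea6.G20.W07C12.StColP RhW07.C12.FieldSplit RhIdea6.G21.W07C13.TentMax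
open RhW07.C14.TwoSided RhW07.C14.Classes RhW07.C14.Lineage RhW07.C14.Booking

/-! ## §W the WALK-BACK GLUE-G3A, PROVED (crit-1 CUT 6 flag on `stub_glueG3`): five one-level laws + the low-pair landing law ⇒ the modulus law
The induction is `ChainWalk.chain_walk2` (abstract, above).  Here it is INSTANTIATED on the far nodes of a frame: chain start = the nearest level-wise
entry below the charged node (`Nat.find`), one far node per level (choice), and — the point of v3 — the creep sum is booked at the LOWEST-STATE heights
`b_{i+1}` of the next level, for which BOTH bookkeeping inputs are THEOREMS: monotonicity (`lowest_le_child`, `child_le_state`: the tree's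
`RhW08.SuccB.stTrkDQ_succ_of_nested`) and the quarter DROP after an uncharged level while a later level is charged (`state_drop`: readiness
`ReadyR2` is STATE-FREE and cumulative — `stateFree_readyR2`, `readyR2_mono` — so the uncharged level's lowest state is not ready and `¬Charged`
leaves only its `s/4`-successor).  No child-drop law is assumed (a hot pair in a horizontal field `k` drops only `1/(2k²b)` per level — T-DROP data:
charged consecutive far pairs drop as little as `0.052·s`).  The one sub-case the state booking does not separate — the chain JUMPS at a creep step to
a pair lying in the landing zone of the current field (`κ_i·b_{i+1} < 5/4 ≤ κ_i·Im w_i`) — is closed by the LOW-PAIR LANDING LAW `LowLandingLaw (5/4) 2`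
(T-LOW; on linked chains it is WEAKER than T-LZ) at the price of ONE unseparated creep factor `(1 + θu/5)` in the constant:
`λ = (1+θ)(1+θ')e^{2θu}(1+θu/5) = 1.1165` of record, `λ² = 1.2466 ≤ 5/4` (`lam_sq_le_recordB`, kernel: `e^{0.12} = (e^{0.03})⁴ ≤ (100/97)⁴`). -/

/-- (T-LOW) **low-pair landing law** `LowLandingLaw c m`: consecutive far nodes `(i, v, w)`, `(i+1, v', w')`, node `i` hot (`η/s < κ_i`) and the next
lowest state INSIDE the landing zone of that field (`κ_i·Im v' < c`) ⇒ every state is `ReadyR2` by level `i + 1 + m`.  Of record `c = 5/4`, `m = 2`.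
On a linked chain (`v' = w`) the hypothesis is node `i`'s own landing-zone condition, so there the law is implied by `LandingExitLawAbove' c m` (indeed by
its weakening to `m + 1`); the new content is the JUMP population (the lowest pair of level `i+1` is another, lower pair: height `< 5/(4κ_i) < 5s/(4η)`,
field `≲ 1.1κ_i` in a legal frame ⇒ `k·b' < 1.4` ⇒ real child within two levels ⇒ NL event ⇒ `TiltReady`).  Column T-LOW: rows = consecutive far
levels with `κ_i > η/s`, `κ_i·vy_{i+1} < 5/4`; PASS iff `firstNL ≤ i + 3`; KILL one legal row without. -/
def LowLandingLaw (c : ℝ) (m : ℕ) : Prop :=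
  ∀ (η : ℝ) (f : ℂ → ℂ) (x₀ s hmax R Hs : ℝ) (B : ℕ), EngineHyps5 2 η f x₀ s hmax R Hs B →
    ∀ (i : ℕ) (v w v' w' : ℂ), FarNode' η f x₀ s hmax R Hs B i v w → FarNode' η f x₀ s hmax R Hs B (i + 1) v' w' →
      η / s < ‖farFieldAt f i v w‖ → ‖farFieldAt f i v w‖ * v'.im < c → ∀ u : ℂ, ReadyR2 η f x₀ s hmax R Hs B (i + 1 + m) u

/-- (K) the axis-centred binder is the tree's `NestedStep`. -/
theorem nestedStep_of_binder {v w : ℂ} (h : ‖w - (v.re : ℂ)‖ ≤ |v.im|) : NestedStep v w := by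
  unfold NestedStep
  have h2 : ‖w - (v.re : ℂ)‖ ^ 2 ≤ |v.im| ^ 2 := pow_le_pow_left₀ (norm_nonneg _) h 2
  rw [sq_abs, Complex.sq_norm, Complex.normSq_apply] at h2
  simp only [Complex.sub_re, Complex.ofReal_re, Complex.sub_im, Complex.ofReal_im, sub_zero] at h2
  nlinarith [h2]

/-- (K) a nested child lies no higher than its state: `Im w ≤ |Im v|`. -/
theorem im_le_of_binder {v w : ℂ} (h : ‖w - (v.re : ℂ)‖ ≤ |v.im|) : w.im ≤ |v.im| := by
  have h1 : |(w - (v.re : ℂ)).im| ≤ ‖w - (v.re : ℂ)‖ := Complex.abs_im_le_norm _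
  have h2 : (w - (v.re : ℂ)).im = w.im := by simp
  rw [h2] at h1
  exact (le_abs_self _).trans (h1.trans h)

/-- (K) a far node's child is no higher than its state. -/
theorem child_le_state {η : ℝ} {f : ℂ → ℂ} {x₀ s hmax R Hs : ℝ} {B : ℕ} {i : ℕ} {v w : ℂ} (hN : FarNode' η f x₀ s hmax R Hs B i v w) :
    w.im ≤ v.im := by
  obtain ⟨-, hlow, -, -, -, -, hnest⟩ := hN
  have h := im_le_of_binder hnest
  rwa [abs_of_pos hlow.1.2.2.1] at h

/-- ★ (K) **the books' B-β, PROVED**: the child `w` of the level-`i` far node is a band state of level `i+1` (`RhW08.SuccB.stTrkDQ_succ_of_nested`), so the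
lowest state of level `i+1` is no higher than `w`. -/
theorem lowest_le_child {η : ℝ} {f : ℂ → ℂ} {x₀ s hmax R Hs : ℝ} {B : ℕ} (hE : EngineHyps5 2 η f x₀ s hmax R Hs B) {i : ℕ} {v w v' w' : ℂ}
    (hN : FarNode' η f x₀ s hmax R Hs B i v w) (hN' : FarNode' η f x₀ s hmax R Hs B (i + 1) v' w') : v'.im ≤ w.im := by
  obtain ⟨-, hlow, -, -, hw0, hwim, hnest⟩ := hN
  obtain ⟨-, hlow', -, -, -, -, -⟩ := hN'
  exact hlow'.2 w (RhW08.SuccB.stTrkDQ_succ_of_nested hE hlow.1 hw0 hwim (nestedStep_of_binder hnest))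

/-- (K) child heights are monotone along consecutive far nodes. -/
theorem child_mono {η : ℝ} {f : ℂ → ℂ} {x₀ s hmax R Hs : ℝ} {B : ℕ} (hE : EngineHyps5 2 η f x₀ s hmax R Hs B) {i : ℕ} {v w v' w' : ℂ}
    (hN : FarNode' η f x₀ s hmax R Hs B i v w) (hN' : FarNode' η f x₀ s hmax R Hs B (i + 1) v' w') : w'.im ≤ w.im :=
  (child_le_state hN').trans (lowest_le_child hE hN hN')

/-- ★ (K) **STATE DROP, PROVED** (replaces any child-drop law): if level `i+1` is uncharged while some level `j ≥ i+2` is charged, the lowest state of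
level `i+2` sits `s/4` below the lowest state of level `i+1`.  (`ReadyR2` is state-free and cumulative, so a ready `v'` would un-charge every later
level; hence `v'` is not ready and `¬Charged (i+1)` yields the quarter-successor `u'` of `PTrkSQ PBot`, above which the lowest state of `i+2` cannot lie.) -/
theorem state_drop {η : ℝ} {f : ℂ → ℂ} {x₀ s hmax R Hs : ℝ} {B : ℕ} {i j : ℕ} {v' w' v'' w'' : ℂ}
    (hN' : FarNode' η f x₀ s hmax R Hs B (i + 1) v' w') (hN'' : FarNode' η f x₀ s hmax R Hs B (i + 2) v'' w'')
    (hnch : ¬ Charged (PTrkSQ PBot) StTrkDQ ReadyR2 η f x₀ s hmax R Hs B (i + 1)) (hij : i + 2 ≤ j)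
    (hch : Charged (PTrkSQ PBot) StTrkDQ ReadyR2 η f x₀ s hmax R Hs B j) : v''.im ≤ v'.im - s / 4 := by
  obtain ⟨-, hlow1, -, -, -, -, -⟩ := hN'
  obtain ⟨-, hlow2, -, -, -, -, -⟩ := hN''
  have hcase : ReadyR2 η f x₀ s hmax R Hs B (i + 1) v' ∨ PTrkSQ PBot η f x₀ s hmax R Hs B (i + 1) v' := by
    by_contra h
    exact hnch ⟨v', hlow1, fun hR => h (Or.inl hR), fun hP => h (Or.inr hP)⟩
  rcases hcase with hR | hP
  · exfalso
    refine not_charged_of_readyR2_all (fun u => ?_) hch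
    exact readyR2_mono (by omega : i + 1 ≤ j) (stateFree_readyR2 η f x₀ s hmax R Hs B (i + 1) v' u hR)
  · rcases hP with hbot | ⟨u', hu', hdrop⟩
    · exact absurd hbot id
    · have hu'pos : 0 < u'.im := hu'.2.2.1
      have hv'pos : 0 < v'.im := hlow1.1.2.2.1
      have h1 : v''.im ≤ u'.im := hlow2.2 u' hu'
      rw [abs_of_pos hu'pos, abs_of_pos hv'pos] at hdrop
      linarith

/-- (K) the numeric side condition of the walk at `Λ₀ = 2`: `λ₀² ≤ 5/4`, `0 ≤ η`, `2η ≤ 1` ⇒ `B s (5/(4·λ₀·(η/s))) ≤ 2` (equality at `λ₀η = 9/16`). -/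
theorem B_walk_le_two {θ θu θ' η s : ℝ} (hs : 0 < s) (hη0 : 0 ≤ η) (hη1 : 2 * η ≤ 1) (hθ : 0 ≤ θ) (hθ' : 0 ≤ θ')
    (hlam : ((1 + θ) * (1 + θ') * Real.exp (2 * θu)) ^ 2 ≤ 5 / 4) :
    ChainWalk.B s (5 / (4 * ((1 + θ) * (1 + θ') * (η / s) * Real.exp (θu * 2)))) ≤ 2 := by
  set L : ℝ := (1 + θ) * (1 + θ') * Real.exp (2 * θu) with hL
  have hL0 : 0 < L := by rw [hL]; positivity
  have hK : (1 + θ) * (1 + θ') * (η / s) * Real.exp (θu * 2) = L * η / s := by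
    rw [hL, mul_comm θu 2]; ring
  rw [hK]
  rcases hη0.eq_or_lt with h0 | hηpos
  · rw [← h0]; simp [ChainWalk.B]
  · have hu : 0 < 5 / (4 * (L * η / s)) := by positivity
    refine ChainWalk.B_le_two (t := L * η) hu ?_ (by positivity) ?_
    · field_simp
    · have : (L * η) ^ 2 = L ^ 2 * η ^ 2 := by ring
      rw [this]
      have hη2 : η ^ 2 ≤ 1 / 4 := by nlinarith
      calc L ^ 2 * η ^ 2 ≤ 5 / 4 * (1 / 4) := mul_le_mul hlam hη2 (by positivity) (by positivity)
        _ = 5 / 16 := by norm_num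

/-- (K) the final factor: `(K·s)² = λ₀²η² ≤ 5/16` ⇒ `s²/(5/(4K))² = 16(Ks)²/25 ≤ 1/5`. -/
theorem final_factor_le {L η s : ℝ} (hs : 0 < s) (hη0 : 0 ≤ η) (hη1 : 2 * η ≤ 1) (hL0 : 0 < L) (hlam : L ^ 2 ≤ 5 / 4) :
    s ^ 2 / (5 / (4 * (L * η / s))) ^ 2 ≤ 1 / 5 := by
  rcases hη0.eq_or_lt with h0 | hηpos
  · rw [← h0]; simp
  · have hkey : s ^ 2 / (5 / (4 * (L * η / s))) ^ 2 = 16 * (L ^ 2 * η ^ 2) / 25 := by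
      field_simp
      ring
    rw [hkey]
    have hη2 : η ^ 2 ≤ 1 / 4 := by nlinarith
    have : L ^ 2 * η ^ 2 ≤ 5 / 4 * (1 / 4) := mul_le_mul hlam hη2 (by positivity) (by positivity)
    linarith

/-- ★★★ (K) **GLUE-G3A PROVED**: the five one-level laws of record + the low-pair landing law ⇒ the axis-centred modulus law with constant
`λ = (1+θ)(1+θ')e^{2θu}·(1+θu/5)`.  (`ChainWalk.chain_walk2` on the far nodes of a frame; start at the nearest level-wise entry; `B ≤ 2` by `B_walk_le_two`.) -/
theorem modulusLawA_of_laws {θ θu θ' : ℝ} (hθ : 0 ≤ θ) (hθu : 0 ≤ θu) (hθ' : 0 ≤ θ')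
    (hlam : ((1 + θ) * (1 + θ') * Real.exp (2 * θu)) ^ 2 ≤ 5 / 4)
    (hL : LandingExitLawAbove' (5 / 4) 2) (hW : LowLandingLaw (5 / 4) 2) (hC : ThresholdCapLawCharged' θ) (hB : ThresholdCapLawBelow' θ)
    (hU : UnchargedCreepLaw' θu) (hX : FarChainEntryExitLaw' θ') :
    FarFieldModulusLawA' ((1 + θ) * (1 + θ') * Real.exp (2 * θu) * (1 + θu / 5)) := by
  intro η f x₀ s hmax R Hs B hE j v w hfar hch hlow hvnz hiso hw0 hwim hnest
  classical
  have hE' := hE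
  obtain ⟨-, -, -, hs, -, -, -, -, -, -, -, -, -, hη0, hη1, -⟩ := hE'
  have hXc := farChainEntryLawCharged_of_exit' θ' hX
  have hc0 : 0 ≤ η / s := div_nonneg hη0 hs.le
  have hthr_le : η / s ≤ (1 + θ) * (η / s) := le_mul_of_one_le_left hc0 (by linarith)
  have hNj : FarNode' η f x₀ s hmax R Hs B j v w := ⟨hfar, hlow, hvnz, hiso, hw0, hwim, hnest⟩
  -- the chain start: the nearest level-wise entry `k ≤ j` with far nodes at every level of `[k, j)`
  obtain ⟨k, hkj, hk, hent⟩ : ∃ k : ℕ, k ≤ j ∧ (∀ i : ℕ, k ≤ i → i < j → ∃ v₀ w₀ : ℂ, FarNode' η f x₀ s hmax R Hs B i v₀ w₀) ∧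
      FarEntry' η f x₀ s hmax R Hs B k := by
    have hex : ∃ k : ℕ, ∀ i : ℕ, k ≤ i → i < j → ∃ v₀ w₀ : ℂ, FarNode' η f x₀ s hmax R Hs B i v₀ w₀ :=
      ⟨j, fun i h1 h2 => absurd h2 (not_lt.2 h1)⟩
    refine ⟨Nat.find hex, Nat.find_min' hex (fun i h1 h2 => absurd h2 (not_lt.2 h1)), Nat.find_spec hex, ?_⟩
    by_cases hk0 : Nat.find hex = 0
    · exact Or.inl hk0
    · right
      intro v₀ w₀ hN0
      have hlt : Nat.find hex - 1 < Nat.find hex := by omega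
      apply Nat.find_min hex hlt
      intro i h1 h2
      by_cases hi : i = Nat.find hex - 1
      · subst hi; exact ⟨v₀, w₀, hN0⟩
      · exact Nat.find_spec hex i (by omega) h2
  -- one far node per level of `[k, j]`, the given one at `j`
  obtain ⟨nd, hN, hNjeq⟩ : ∃ nd : ℕ → ℂ × ℂ, (∀ i : ℕ, k ≤ i → i ≤ j → FarNode' η f x₀ s hmax R Hs B i (nd i).1 (nd i).2) ∧ nd j = (v, w) := by
    refine ⟨fun i => if h : k ≤ i ∧ i < j then (Classical.choose (hk i h.1 h.2), Classical.choose (Classical.choose_spec (hk i h.1 h.2))) else (v, w),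
      ?_, ?_⟩
    · intro i h1 h2
      by_cases hlt : i < j
      · have hh : k ≤ i ∧ i < j := ⟨h1, hlt⟩
        simp only [dif_pos hh]
        exact Classical.choose_spec (Classical.choose_spec (hk i h1 hlt))
      · obtain rfl : i = j := le_antisymm h2 (not_lt.1 hlt)
        simp only [dif_neg (fun h : k ≤ i ∧ i < i => lt_irrefl _ h.2)]
        exact hNj
    · simp only [dif_neg (fun h : k ≤ j ∧ j < j => lt_irrefl _ h.2)]
  -- THE WALK (state-height booking `Y i = Im (nd (i+1)).1`)
  have hw : ‖farFieldAt f j (nd j).1 (nd j).2‖ ≤ (1 + θ) * (1 + θ') * (η / s) * Real.exp (θu * 2) *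
      (1 + θu * (s ^ 2 / (5 / (4 * ((1 + θ) * (1 + θ') * (η / s) * Real.exp (θu * 2)))) ^ 2)) := by
    refine ChainWalk.chain_walk2 (κ := fun i => ‖farFieldAt f i (nd i).1 (nd i).2‖) (y := fun i => (nd i).2.im) (Y := fun i => (nd (i + 1)).1.im)
      (ch := fun i => Charged (PTrkSQ PBot) StTrkDQ ReadyR2 η f x₀ s hmax R Hs B i) (Λ₀ := 2)
      hkj hs hc0 hθ hθ' hθu (B_walk_le_two hs hη0 hη1 hθ hθ' hlam) ?_ ?_ ?_ ?_ ?_ ?_ ?_ ?_ ?_ ?_ ?_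
    · show Charged (PTrkSQ PBot) StTrkDQ ReadyR2 η f x₀ s hmax R Hs B j
      exact hch
    · -- entry, charged: B5 (corollary of the exit law)
      intro hchk
      have := hXc η f x₀ s hmax R Hs B hE k (nd k).1 (nd k).2 (hN k le_rfl hkj) hent hchk
      rwa [mul_div_assoc] at this
    · -- entry, hot: exit law (no later charge while far)
      intro _ hhot i hki hij
      exact hX η f x₀ s hmax R Hs B hE k (nd k).1 (nd k).2 (hN k le_rfl hkj) hent (by rw [mul_div_assoc]; exact hhot) i hki
        (fun i' h1 h2 => (hN i' h1 (h2.trans hij)).1)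
    · -- charged successor: cap
      intro i hki hij hchi
      obtain ⟨hfar0, hlow0, hvnz0, hiso0, hw00, hwim0, hnest0⟩ := hN i hki hij.le
      obtain ⟨hfar1, hlow1, hvnz1, hiso1, hw01, hwim1, hnest1⟩ := hN (i + 1) (by omega) (by omega)
      have := hC η f x₀ s hmax R Hs B hE i (nd i).1 (nd i).2 (nd (i + 1)).1 (nd (i + 1)).2 hfar0 hfar1 hchi hlow0 hvnz0 hiso0 hw00 hwim0 hnest0
        hlow1 hvnz1 hiso1 hw01 hwim1 hnest1
      rwa [mul_div_assoc] at this
    · -- below threshold: cap-below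
      intro i hki hij hκ
      obtain ⟨hfar0, hlow0, hvnz0, hiso0, hw00, hwim0, hnest0⟩ := hN i hki hij.le
      obtain ⟨hfar1, hlow1, hvnz1, hiso1, hw01, hwim1, hnest1⟩ := hN (i + 1) (by omega) (by omega)
      exact hB η f x₀ s hmax R Hs B hE i (nd i).1 (nd i).2 (nd (i + 1)).1 (nd (i + 1)).2 hfar0 hfar1 hlow0 hvnz0 hiso0 hw00 hwim0 hnest0
        hlow1 hvnz1 hiso1 hw01 hwim1 hnest1 (by rw [mul_div_assoc]; exact hκ) |>.trans_eq (mul_div_assoc _ _ _)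
    · -- creep (child form)
      intro i hki hij hnch hhot hlz
      obtain ⟨hfar0, hlow0, hvnz0, hiso0, hw00, hwim0, hnest0⟩ := hN i hki hij.le
      obtain ⟨hfar1, hlow1, hvnz1, hiso1, hw01, hwim1, hnest1⟩ := hN (i + 1) (by omega) (by omega)
      have := hU η f x₀ s hmax R Hs B hE i (nd i).1 (nd i).2 (nd (i + 1)).1 (nd (i + 1)).2 hfar0 hfar1 hnch hlow0 hvnz0 hiso0 hw00 hwim0 hnest0
        hlow1 hvnz1 hiso1 hw01 hwim1 hnest1 (lt_of_le_of_lt hthr_le hhot) hlz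
      rwa [mul_div_assoc] at this
    · -- landing zone, child form: no charge from level i+2 on
      intro i hki hij hhot hlz i' h1 _
      exact no_charge_after_landing_above' hL hE (hN i hki hij.le) (lt_of_le_of_lt hthr_le hhot) hlz i' h1
    · -- landing zone, state form (the jump to a low pair): no charge from level i+3 on
      intro i hki hij hhot hlz i' h1 _
      exact not_charged_of_readyR2_all fun u => readyR2_mono (by omega : i + 1 + 2 ≤ i')
        (hW η f x₀ s hmax R Hs B hE i (nd i).1 (nd i).2 (nd (i + 1)).1 (nd (i + 1)).2 (hN i hki hij.le) (hN (i + 1) (by omega) (by omega))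
          (lt_of_le_of_lt hthr_le hhot) hlz u)
    · -- Y ≤ y: the next lowest state is no higher than the child (PROVED, B-β)
      intro i hki hij
      exact lowest_le_child hE (hN i hki hij.le) (hN (i + 1) (by omega) (by omega))
    · -- Y monotone (PROVED)
      intro i hki hij
      exact (lowest_le_child hE (hN (i + 1) (by omega) (by omega)) (hN (i + 2) (by omega) (by omega))).trans
        (child_le_state (hN (i + 1) (by omega) (by omega)))
    · -- Y drops s/4 after an uncharged level while level j is charged (PROVED)
      intro i hki hij2 hnch
      exact state_drop (hN (i + 1) (by omega) (by omega)) (hN (i + 2) (by omega) hij2) hnch hij2 hch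
  rw [hNjeq] at hw
  -- the constant: K·(1 + θu·s²/Ymin²) ≤ λ₀(1 + θu/5)·η/s
  set L : ℝ := (1 + θ) * (1 + θ') * Real.exp (2 * θu) with hLdef
  have hL0 : 0 < L := by rw [hLdef]; positivity
  have hK : (1 + θ) * (1 + θ') * (η / s) * Real.exp (θu * 2) = L * η / s := by rw [hLdef, mul_comm θu 2]; ring
  rw [hK] at hw
  have hff := final_factor_le hs hη0 hη1 hL0 hlam
  have hKnn : 0 ≤ L * η / s := by positivity
  calc ‖farFieldAt f j v w‖ ≤ L * η / s * (1 + θu * (s ^ 2 / (5 / (4 * (L * η / s))) ^ 2)) := hw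
    _ ≤ L * η / s * (1 + θu / 5) := by
        apply mul_le_mul_of_nonneg_left _ hKnn
        have := mul_le_mul_of_nonneg_left hff hθu
        linarith
    _ = L * (1 + θu / 5) * η / s := by ring

/-- (K) the numeric side condition of record with the final factor: θ = 1/200, θ' = 1/25, θu = 3/100:
`((1.005·1.04)·e^{0.06}·1.006)² = 1.0924·1.0120·e^{0.12} ≤ 1.10559·(100/97)⁴ = 1.24884 ≤ 5/4` (`e^{0.03} ≤ 1/(1 − 0.03)`). -/
theorem lam_sq_le_recordB : ((1 + 1 / 200) * (1 + 1 / 25) * Real.exp (2 * (3 / 100)) * (1 + 3 / 100 / 5) : ℝ) ^ 2 ≤ 5 / 4 := by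
  have h1 : Real.exp (2 * (3 / 100) : ℝ) = Real.exp (3 / 100) ^ 2 := by
    rw [← Real.exp_nat_mul]; norm_num
  have h2 : Real.exp (3 / 100 : ℝ) ≤ 1 / (1 - 3 / 100) := Real.exp_bound_div_one_sub_of_interval (by norm_num) (by norm_num)
  have h0 : 0 < Real.exp (3 / 100 : ℝ) := Real.exp_pos _
  have h4 : Real.exp (3 / 100 : ℝ) ^ 4 ≤ (1 / (1 - 3 / 100)) ^ 4 := pow_le_pow_left₀ h0.le h2 4
  rw [h1]
  have h5 : ((1 + 1 / 200) * (1 + 1 / 25) * Real.exp (3 / 100) ^ 2 * (1 + 3 / 100 / 5) : ℝ) ^ 2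
      = ((1 + 1 / 200) * (1 + 1 / 25) * (1 + 3 / 100 / 5)) ^ 2 * Real.exp (3 / 100) ^ 4 := by ring
  rw [h5]
  norm_num at h4 ⊢
  linarith [h4]

/-- ★ F1 ASSEMBLY (real proof, v3): GLUE-G3A (`modulusLawA_of_laws`, PROVED) + GLUE-2A `F1OfModulusLawA'` + the five laws of record + the low-pair landing
law ⇒ `FarEnergyLawCQ (4/5)` by name. -/
theorem farEnergyLawCQ_of_lawsB (hF : F1OfModulusLawA') (hL : LandingExitLawAbove' (5 / 4) 2) (hW : LowLandingLaw (5 / 4) 2)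
    (hC : ThresholdCapLawCharged' (1 / 200)) (hB : ThresholdCapLawBelow' (1 / 200)) (hU : UnchargedCreepLaw' (3 / 100))
    (hE : FarChainEntryExitLaw' (1 / 25)) : FarEnergyLawCQ (4 / 5) := by
  have hlam : (0 : ℝ) < (1 + 1 / 200) * (1 + 1 / 25) * Real.exp (2 * (3 / 100)) * (1 + 3 / 100 / 5) := by positivity
  exact hF _ hlam lam_sq_le_recordB (modulusLawA_of_laws (by norm_num) (by norm_num) (by norm_num) lam_sq_le_record hL hW hC hB hU hE)

/-- (K) and the typed glue of v2 follows outright once the low-pair landing law is granted with `θu`-inflated constant — recorded for the registry: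
`ModulusOfLawsG3A'` itself (constant WITHOUT the factor `1+θu/5`) is NOT claimed. -/
theorem modulusLawA_record (hL : LandingExitLawAbove' (5 / 4) 2) (hW : LowLandingLaw (5 / 4) 2) (hC : ThresholdCapLawCharged' (1 / 200))
    (hB : ThresholdCapLawBelow' (1 / 200)) (hU : UnchargedCreepLaw' (3 / 100)) (hE : FarChainEntryExitLaw' (1 / 25)) :
    FarFieldModulusLawA' ((1 + 1 / 200) * (1 + 1 / 25) * Real.exp (2 * (3 / 100)) * (1 + 3 / 100 / 5)) :=
  modulusLawA_of_laws (by norm_num) (by norm_num) (by norm_num) lam_sq_le_record hL hW hC hB hU hE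

end RhW08.BurgersRateG3
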